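import Summits.QuantumFields.YangMills.Theorems.BalabanLadderNTPointwiseFloor
import Summits.QuantumFields.YangMills.Theorems.LangevinControlUVOSLegsFromFemtoAndGapStubLowerBump
import Summits.QuantumFields.YangMills.Theorems.InfiniteVolumeContinuumOnsetFloorsKOfReference
import HarnessLib

/-!
# Leaf `InfiniteVolumeContinuum.HypercubicOSDataFromInfiniteVolume` (stmt-QuantumFields-19868), registered stub
# N `stub_onsetFloorsK : OnsetFloorsK` — part 4: the VOLUME-UNIFORM POINTWISE FLOORS of the NT line «n32-variance»
# (Bałaban's N32 in NT letters + the signed three-point cloud floor; R590-ym item (12)) feed N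

Helper file (`--supports stmt-QuantumFields-19868`) of prover seat `ymfull-r2a-prover-1` (R590-ym item 13), stub N of the
skeleton of record `Cruxes/HypercubicOSDataFromInfiniteVolume/Lines/octave_doubling.lean` (REV 2.1); co-ordinated with
`ymfull-r2a-plan-1` (line `Cruxes/NT/Lines/n32_variance.lean` on crux `NT`, stmt-QuantumFields-19353) and
`ymfull-r2a-prover-2` (its landing kit), HOME `pub/ideators/ym-idea-2/STATUS.md` 2026-08-30.

The NT line «n32-variance» replaces `RefPkgT` by two stubs, `N32T` (∀ compact simple `G` ∃ `(r, a)`, `a > 0`, `a → 0`,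
`UniformTwoPointFloor G r a`: a β- and VOLUME-uniform pointwise floor `ν·a(β)⁸ ≤ Cov_T(A_x, A_y)` on every pair at
physical separation `a(β)‖y−x‖ ∈ [s₀, s₁]`) and `K3T` (⇒ `UniformThreePointFloor G r a`: a signed floor
`ν₃·a(β)¹² ≤ sgn·κ₃,T(x,y,z)` on the lattice triples charged by three disjoint physical balls), and proves
`NT_of : N32T → K3T → BalabanLadder.NT` with BUMP witnesses (`exists_bump_schwartz`, `tsupport = closedBall`).  Bumps are
compactly supported, so the same glue gives the compact-witness currency.  This file proves it with the two floor
statements UNBUNDLED (their bodies as hypotheses; the line's named defs are not yet a tree module — by-name one-liners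
`N32T → K3T → OnsetFloorsK` follow once its Defs module lands):

* `floorK_fst_of_pointwiseWindowFloor` — the body of `UniformTwoPointFloor G r a` ⇒ clause (i) of `LowerBoundsK G r a`
  (K-twin of the line's `clauseI_of_uniformTwoPointFloor`; bump at height `(s₀+s₁)/4`, tree `PointwiseFloor.q2Floor_of_pointwise_floor`);
* `floorK_snd_of_signedCloudFloor` — the body of `UniformThreePointFloor G r a` ⇒ clause (ii) of `LowerBoundsK G r a`
  (K-twin of `clauseII_of_uniformThreePointFloor`; three bumps, signed one-torus pigeonhole, `CeilingPrice.tendsto_envelope`);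
* `lowerBoundsK_of_uniformFloors`, `onsetFloorsK_of_uniformFloors` — hence `LowerBoundsK G r a` and, for the SU(2) class
  with `∃ (r, a)`, the leaf's stub N `OnsetFloorsK` (via part 2's `onsetFloorsK_of_lowerBoundsK`).

Proofs adapted from `Cruxes/NT/Lines/n32_variance.lean` §§2–4 (planner `ymfull-r2a-plan-1`), geometric steps inlined.

HONEST LABEL: CONDITIONAL reduction; `N32T`, `K3T` are OPEN (N32 = [Balaban1989LargeFieldII] p. 356, announced, not
printed); nothing here proves a floor, the leaf, any crux, rung or summit; finite-volume / conditional content only; the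
Yang–Mills mass gap is NOT proved.
-/

set_option autoImplicit false

noncomputable section

open scoped SchwartzMap
open MeasureTheory Filter Topology Metric
open Literature.MathematicalPhysics.QuantumFieldTheory Literature.MathematicalPhysics.QuantumLattice
open Literature.Probability.LatticeModels
open Summit.QuantumFields.YangMills.Cruxes.OSLegsFromFemtoAndGap.DlrCollarTransfer
open Summit.QuantumFields.YangMills.Theorems.OSLegsFromFemtoAndGap.StubLower
  (exists_bump_schwartz abs_apply_le_norm timeReflection_single_zero norm_single_zero siteToE_sub)
open Summit.QuantumFields.YangMills.Cruxes.NT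
open Summit.QuantumFields.YangMills.Cruxes.AtomicCalibrationR.MirrorCalibration (LowerBoundsK OnsetFloorsK)

namespace Summit.QuantumFields.YangMills.Cruxes.HypercubicOSDataFromInfiniteVolume.OnsetFloorsN

section Floors

variable (G : Type) [Group G] [TopologicalSpace G] [IsTopologicalGroup G] [CompactSpace G]
  [MeasurableSpace G] [BorelSpace G] (r : LatticeRep G)

/-- **Clause (i) of `LowerBoundsK` from the volume-uniform pointwise window floor** (the body of the line's
`UniformTwoPointFloor G r a`): a non-negative bump `v` at height `t₀ = (s₀+s₁)/4` with support radius `(s₁−s₀)/8`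
charges only pairs inside the window `[s₀, s₁]`, where `ν a⁸ ≤ Cov_T` holds on every large torus; the tree's
`PointwiseFloor.q2Floor_of_pointwise_floor` gives `ε ≤ Q2(θv, v)`; `tsupport v = closedBall` gives the compact support.
[folklore] -/
theorem floorK_fst_of_pointwiseWindowFloor (a : ℝ → ℝ) (ha : ∀ β, 0 < a β) (ha0 : Tendsto a atTop (𝓝 0))
    {ν s₀ s₁ β₅ Λ₅ : ℝ} (hν : 0 < ν) (hs₀ : 0 < s₀) (hs₀₁ : s₀ < s₁)
    (hfl : ∀ β : ℝ, β₅ ≤ β → ∀ L : ℕ, Λ₅ ≤ a β * L → ∀ x ∈ box 4 L, ∀ y ∈ box 4 L,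
      s₀ ≤ a β * ‖siteToE (y - x)‖ → a β * ‖siteToE (y - x)‖ ≤ s₁ →
        ν * a β ^ 8 ≤ torusE G r β L (fun U => dens G r x U * dens G r y U) -
          torusE G r β L (dens G r x) * torusE G r β L (dens G r y)) :
    ∃ (v : 𝓢(EuclideanSpace ℝ (Fin 4), ℝ)) (ε β₆ Λ₆ : ℝ),
      HasCompactSupport (v : EuclideanSpace ℝ (Fin 4) → ℝ) ∧
      tsupport (v : EuclideanSpace ℝ (Fin 4) → ℝ) ⊆ {y : EuclideanSpace ℝ (Fin 4) | 0 < y 0} ∧ 0 < ε ∧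
      ∀ β : ℝ, β₆ ≤ β → ∀ L : ℕ, Λ₆ ≤ a β * L → ε ≤ Q2 G r β L (a β) (thetaTest 4 v) v := by
  -- adapted from `N32Variance.clauseI_of_uniformTwoPointFloor` (line n32_variance), geometry inlined
  set t₀ : ℝ := (s₀ + s₁) / 4 with ht₀
  set ρ : ℝ := (s₁ - s₀) / 16 with hρ
  have hρ0 : 0 < ρ := by rw [hρ]; linarith
  have ht₀0 : 0 ≤ t₀ := by rw [ht₀]; linarith
  obtain ⟨v, hv0, -, hvone, hvsupp, hvts⟩ := exists_bump_schwartz (EuclideanSpace.single 0 t₀) hρ0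
  set p : EuclideanSpace ℝ (Fin 4) := EuclideanSpace.single 0 t₀ with hp
  -- compact support
  have hK : HasCompactSupport (v : EuclideanSpace ℝ (Fin 4) → ℝ) := by
    show IsCompact (tsupport (v : EuclideanSpace ℝ (Fin 4) → ℝ))
    rw [hvts]; exact isCompact_closedBall _ _
  -- positive time: the closed ball of radius `2ρ < t₀` around `t₀ e₀`
  have hpos : tsupport (v : EuclideanSpace ℝ (Fin 4) → ℝ) ⊆ {y : EuclideanSpace ℝ (Fin 4) | 0 < y 0} := by
    rw [hvts]
    intro y hy
    rw [mem_closedBall, dist_eq_norm] at hy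
    have h1 := abs_apply_le_norm (y - EuclideanSpace.single 0 t₀) 0
    have h2 : |y 0 - t₀| ≤ 2 * ρ := by simpa using h1.trans hy
    have h3 := (abs_le.1 h2).1
    show 0 < y 0
    have : 2 * ρ < t₀ := by rw [ht₀, hρ]; linarith
    linarith
  -- a ball around the origin containing the support
  have hvσ : tsupport (v : EuclideanSpace ℝ (Fin 4) → ℝ) ⊆ closedBall 0 (2 * ρ + t₀) := by
    rw [hvts]
    refine closedBall_subset_closedBall' ?_
    rw [dist_zero_right, norm_single_zero, abs_of_nonneg ht₀0]
  -- positive mass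
  have hv1 : 0 < ∫ y, |v y| := by
    have e : (fun y => |v y|) = fun y => v y := funext fun y => abs_of_nonneg (hv0 y)
    rw [e]
    exact v.continuous.integral_pos_of_hasCompactSupport_nonneg_nonzero hK (fun z => hv0 z)
      (x := EuclideanSpace.single 0 t₀) (by rw [hvone _ (by rw [dist_self]; exact hρ0.le)]; norm_num)
  -- the cloud floor: charged pairs lie in the window
  have hpp : ‖p + p‖ = 2 * t₀ := by
    rw [← two_smul ℝ p, norm_smul, hp, norm_single_zero, Real.norm_of_nonneg (by norm_num : (0:ℝ) ≤ 2),
      abs_of_nonneg ht₀0]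
  have hcloud : ∀ β : ℝ, β₅ ≤ β → ∀ L : ℕ, Λ₅ ≤ a β * L → ∀ x ∈ box 4 L, ∀ y ∈ box 4 L,
      thetaTest 4 v (a β • siteToE x) ≠ 0 → v (a β • siteToE y) ≠ 0 →
        ν * a β ^ 8 ≤ torusE G r β L (fun U => dens G r x U * dens G r y U) -
          torusE G r β L (dens G r x) * torusE G r β L (dens G r y) := by
    intro β hβ L hL x hx y hy hθx hvy
    rw [thetaTest_apply] at hθx
    have hu := hvsupp _ hθx
    have hw := hvsupp _ hvy
    -- the reflected cloud sits in the window `[2t₀ − 4ρ, 2t₀ + 4ρ] ⊆ [s₀, s₁]`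
    set u : EuclideanSpace ℝ (Fin 4) := a β • siteToE x with hu'
    set w : EuclideanSpace ℝ (Fin 4) := a β • siteToE y with hw'
    have hu2 : ‖u + p‖ < 2 * ρ := by
      rw [dist_eq_norm] at hu
      have h : timeReflection 4 u - p = timeReflection 4 (u + p) := by
        rw [map_add, hp, timeReflection_single_zero]; abel
      rwa [h, LinearIsometryEquiv.norm_map] at hu
    have hw2 : ‖w - p‖ < 2 * ρ := by rwa [dist_eq_norm] at hw
    have e : w - u = (w - p - (u + p)) + (p + p) := by abel
    have h1 : ‖w - p - (u + p)‖ ≤ ‖w - p‖ + ‖u + p‖ := norm_sub_le _ _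
    have hlo : 2 * t₀ - 4 * ρ ≤ ‖w - u‖ := by
      have h2 : ‖p + p‖ ≤ ‖w - u‖ + ‖w - p - (u + p)‖ := by
        have : p + p = (w - u) - (w - p - (u + p)) := by rw [e]; abel
        rw [this]; exact norm_sub_le _ _
      linarith
    have hhi : ‖w - u‖ ≤ 2 * t₀ + 4 * ρ := by
      have h2 : ‖w - u‖ ≤ ‖w - p - (u + p)‖ + ‖p + p‖ := by rw [e]; exact norm_add_le _ _
      linarith
    have hnorm : a β * ‖siteToE (y - x)‖ = ‖w - u‖ := by
      rw [hw', hu', ← smul_sub, ← siteToE_sub, norm_smul, Real.norm_of_nonneg (ha β).le]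
    refine hfl β hβ L hL x hx y hy ?_ ?_
    · rw [hnorm]; refine le_trans ?_ hlo
      rw [ht₀, hρ]; linarith
    · rw [hnorm]; refine hhi.trans ?_
      rw [ht₀, hρ]; linarith
  obtain ⟨ε, β₆, Λ₆, hε, hfloor⟩ :=
    PointwiseFloor.q2Floor_of_pointwise_floor G r a ha ha0 hv0 hv1 hvσ hν hcloud
  exact ⟨v, ε, β₆, Λ₆, hK, hpos, hε, hfloor⟩

/-- **Clause (ii) of `LowerBoundsK` from the signed volume-uniform three-point cloud floor** (the body of the line's
`UniformThreePointFloor G r a`): three non-negative bumps of support radius `ρ` around `p₁, p₂, p₃` (pairwise disjoint,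
compact supports) charge only triples of the cloud; the signed floor `ν₃ a¹² ≤ sgn·κ₃` summed against the non-negative
weights and the Riemann envelopes `a⁴Σ|f| → ‖f‖₁` (`CeilingPrice.tendsto_envelope`) give
`|Q3(f,g,h)| ≥ ν₃‖f‖₁‖g‖₁‖h‖₁/2` on every large torus. [folklore] -/
theorem floorK_snd_of_signedCloudFloor (a : ℝ → ℝ) (ha : ∀ β, 0 < a β) (ha0 : Tendsto a atTop (𝓝 0))
    {p₁ p₂ p₃ : EuclideanSpace ℝ (Fin 4)} {ρ ν₃ sgn β₅ Λ₅ : ℝ} (hρ : 0 < ρ)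
    (h12 : 2 * ρ < dist p₁ p₂) (h23 : 2 * ρ < dist p₂ p₃) (h13 : 2 * ρ < dist p₁ p₃) (hν₃ : 0 < ν₃)
    (hsgn : sgn = 1 ∨ sgn = -1)
    (hfl : ∀ β : ℝ, β₅ ≤ β → ∀ L : ℕ, Λ₅ ≤ a β * L → ∀ x ∈ box 4 L, ∀ y ∈ box 4 L, ∀ z ∈ box 4 L,
      a β • siteToE x ∈ closedBall p₁ ρ → a β • siteToE y ∈ closedBall p₂ ρ → a β • siteToE z ∈ closedBall p₃ ρ →
        ν₃ * a β ^ 12 ≤ sgn * torusK3 G r β L x y z) :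
    ∃ (f g h : 𝓢(EuclideanSpace ℝ (Fin 4), ℝ)) (ε β₆ Λ₆ : ℝ),
      HasCompactSupport (f : EuclideanSpace ℝ (Fin 4) → ℝ) ∧ HasCompactSupport (g : EuclideanSpace ℝ (Fin 4) → ℝ) ∧
      HasCompactSupport (h : EuclideanSpace ℝ (Fin 4) → ℝ) ∧
      Disjoint (tsupport (f : EuclideanSpace ℝ (Fin 4) → ℝ)) (tsupport (g : EuclideanSpace ℝ (Fin 4) → ℝ)) ∧
      Disjoint (tsupport (g : EuclideanSpace ℝ (Fin 4) → ℝ)) (tsupport (h : EuclideanSpace ℝ (Fin 4) → ℝ)) ∧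
      Disjoint (tsupport (f : EuclideanSpace ℝ (Fin 4) → ℝ)) (tsupport (h : EuclideanSpace ℝ (Fin 4) → ℝ)) ∧ 0 < ε ∧
      ∀ β : ℝ, β₆ ≤ β → ∀ L : ℕ, Λ₆ ≤ a β * L → ε ≤ |Q3 G r β L (a β) f g h| := by
  -- adapted from `N32Variance.clauseII_of_uniformThreePointFloor` (line n32_variance), with compact supports recorded
  have hρ2 : 0 < ρ / 2 := by positivity
  have eρ : 2 * (ρ / 2) = ρ := by ring
  obtain ⟨f, hf0, -, hfone, hfsupp, hfts⟩ := exists_bump_schwartz p₁ hρ2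
  obtain ⟨g, hg0, -, hgone, hgsupp, hgts⟩ := exists_bump_schwartz p₂ hρ2
  obtain ⟨h, hh0, -, hhone, hhsupp, hhts⟩ := exists_bump_schwartz p₃ hρ2
  rw [eρ] at hfsupp hfts hgsupp hgts hhsupp hhts
  -- compact supports
  have hfK : HasCompactSupport (f : EuclideanSpace ℝ (Fin 4) → ℝ) := by
    show IsCompact (tsupport (f : EuclideanSpace ℝ (Fin 4) → ℝ)); rw [hfts]; exact isCompact_closedBall _ _
  have hgK : HasCompactSupport (g : EuclideanSpace ℝ (Fin 4) → ℝ) := by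
    show IsCompact (tsupport (g : EuclideanSpace ℝ (Fin 4) → ℝ)); rw [hgts]; exact isCompact_closedBall _ _
  have hhK : HasCompactSupport (h : EuclideanSpace ℝ (Fin 4) → ℝ) := by
    show IsCompact (tsupport (h : EuclideanSpace ℝ (Fin 4) → ℝ)); rw [hhts]; exact isCompact_closedBall _ _
  -- disjoint supports
  have hfg : Disjoint (tsupport (f : EuclideanSpace ℝ (Fin 4) → ℝ)) (tsupport (g : EuclideanSpace ℝ (Fin 4) → ℝ)) := by
    rw [hfts, hgts]; exact closedBall_disjoint_closedBall (by linarith)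
  have hgh : Disjoint (tsupport (g : EuclideanSpace ℝ (Fin 4) → ℝ)) (tsupport (h : EuclideanSpace ℝ (Fin 4) → ℝ)) := by
    rw [hgts, hhts]; exact closedBall_disjoint_closedBall (by linarith)
  have hfh : Disjoint (tsupport (f : EuclideanSpace ℝ (Fin 4) → ℝ)) (tsupport (h : EuclideanSpace ℝ (Fin 4) → ℝ)) := by
    rw [hfts, hhts]; exact closedBall_disjoint_closedBall (by linarith)
  -- one ball around the origin containing the three supports
  set σ : ℝ := ‖p₁‖ + ‖p₂‖ + ‖p₃‖ + ρ with hσ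
  have hfσ : tsupport (f : EuclideanSpace ℝ (Fin 4) → ℝ) ⊆ closedBall 0 σ := by
    rw [hfts]; refine closedBall_subset_closedBall' ?_
    rw [dist_zero_right, hσ]; linarith [norm_nonneg p₂, norm_nonneg p₃]
  have hgσ : tsupport (g : EuclideanSpace ℝ (Fin 4) → ℝ) ⊆ closedBall 0 σ := by
    rw [hgts]; refine closedBall_subset_closedBall' ?_
    rw [dist_zero_right, hσ]; linarith [norm_nonneg p₁, norm_nonneg p₃]
  have hhσ : tsupport (h : EuclideanSpace ℝ (Fin 4) → ℝ) ⊆ closedBall 0 σ := by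
    rw [hhts]; refine closedBall_subset_closedBall' ?_
    rw [dist_zero_right, hσ]; linarith [norm_nonneg p₁, norm_nonneg p₂]
  -- positive masses (bump = 1 at its centre, non-negative, compactly supported)
  have hmass : ∀ {w : 𝓢(EuclideanSpace ℝ (Fin 4), ℝ)} {c : EuclideanSpace ℝ (Fin 4)}, (∀ z, 0 ≤ w z) → w c = 1 →
      HasCompactSupport (w : EuclideanSpace ℝ (Fin 4) → ℝ) → 0 < ∫ y, |w y| := by
    intro w c hw0 hwc hwK
    have e : (fun y => |w y|) = fun y => w y := funext fun y => abs_of_nonneg (hw0 y)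
    rw [e]
    exact w.continuous.integral_pos_of_hasCompactSupport_nonneg_nonzero hwK (fun z => hw0 z) (x := c)
      (by rw [hwc]; norm_num)
  have hf1 : 0 < ∫ y, |f y| := hmass hf0 (hfone _ (by rw [dist_self]; exact hρ2.le)) hfK
  have hg1 : 0 < ∫ y, |g y| := hmass hg0 (hgone _ (by rw [dist_self]; exact hρ2.le)) hgK
  have hh1 : 0 < ∫ y, |h y| := hmass hh0 (hhone _ (by rw [dist_self]; exact hρ2.le)) hhK
  -- reference boxes covering the supports and the Riemann envelopes
  set L₁ : ℝ → ℕ := fun β => ⌈σ / a β⌉₊ with hL₁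
  have hL₁σ : ∀ β, σ ≤ a β * L₁ β := fun β => by
    have h1 : σ / a β ≤ L₁ β := Nat.le_ceil _
    calc σ = a β * (σ / a β) := by field_simp [(ha β).ne']
      _ ≤ a β * L₁ β := mul_le_mul_of_nonneg_left h1 (ha β).le
  have hcov : ∀ β (L : ℕ), σ ≤ a β * L → L₁ β ≤ L := fun β L hL => by
    refine Nat.ceil_le.2 ?_
    rw [div_le_iff₀ (ha β), mul_comm]
    exact hL
  have hlim := ((CeilingPrice.tendsto_envelope f hfσ a L₁ ha ha0 (Eventually.of_forall hL₁σ)).mul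
    (CeilingPrice.tendsto_envelope g hgσ a L₁ ha ha0 (Eventually.of_forall hL₁σ))).mul
    (CeilingPrice.tendsto_envelope h hhσ a L₁ ha ha0 (Eventually.of_forall hL₁σ))
  have hP : 0 < (∫ y, |f y|) * (∫ y, |g y|) * (∫ y, |h y|) := mul_pos (mul_pos hf1 hg1) hh1
  have hhalf : (∫ y, |f y|) * (∫ y, |g y|) * (∫ y, |h y|) / 2 < (∫ y, |f y|) * (∫ y, |g y|) * (∫ y, |h y|) := by
    linarith
  obtain ⟨β₆, hβ₆⟩ := ((hlim.eventually (lt_mem_nhds hhalf)).and (eventually_ge_atTop β₅)).exists_forall_of_atTop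
  refine ⟨f, g, h, ν₃ * ((∫ y, |f y|) * (∫ y, |g y|) * (∫ y, |h y|) / 2), β₆, max Λ₅ σ, hfK, hgK, hhK, hfg, hgh, hfh,
    by positivity, fun β hβ L hL => ?_⟩
  obtain ⟨hPβ, hβ5⟩ := hβ₆ β hβ
  have hΛ : Λ₅ ≤ a β * L := (le_max_left _ _).trans hL
  have hσL : σ ≤ a β * L := (le_max_right _ _).trans hL
  -- the signed one-torus floor on the charged cloud, summed against the non-negative weights
  have hc : ∀ x ∈ box 4 L, ∀ y ∈ box 4 L, ∀ z ∈ box 4 L,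
      f (a β • siteToE x) ≠ 0 → g (a β • siteToE y) ≠ 0 → h (a β • siteToE z) ≠ 0 →
        ν₃ * a β ^ 12 ≤ sgn * torusK3 G r β L x y z :=
    fun x hx y hy z hz hfx hgy hhz => hfl β hβ5 L hΛ x hx y hy z hz
      (mem_closedBall.2 (hfsupp _ hfx).le) (mem_closedBall.2 (hgsupp _ hgy).le) (mem_closedBall.2 (hhsupp _ hhz).le)
  have hq : ν₃ * a β ^ 12 * ((∑ x ∈ box 4 L, f (a β • siteToE x)) * (∑ y ∈ box 4 L, g (a β • siteToE y)) *
      (∑ z ∈ box 4 L, h (a β • siteToE z))) ≤ sgn * Q3 G r β L (a β) f g h := by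
    have e : (∑ x ∈ box 4 L, f (a β • siteToE x)) * (∑ y ∈ box 4 L, g (a β • siteToE y)) *
        (∑ z ∈ box 4 L, h (a β • siteToE z)) =
        ∑ x ∈ box 4 L, ∑ y ∈ box 4 L, ∑ z ∈ box 4 L,
          f (a β • siteToE x) * g (a β • siteToE y) * h (a β • siteToE z) := by
      rw [Finset.sum_mul_sum, Finset.sum_mul]
      refine Finset.sum_congr rfl fun x _ => ?_
      rw [Finset.sum_mul_sum]
    rw [e, Finset.mul_sum]
    unfold Q3
    rw [Finset.mul_sum]
    refine Finset.sum_le_sum fun x hx => ?_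
    rw [Finset.mul_sum, Finset.mul_sum]
    refine Finset.sum_le_sum fun y hy => ?_
    rw [Finset.mul_sum, Finset.mul_sum]
    refine Finset.sum_le_sum fun z hz => ?_
    by_cases hfx : f (a β • siteToE x) = 0
    · simp [hfx]
    by_cases hgy : g (a β • siteToE y) = 0
    · simp [hgy]
    by_cases hhz : h (a β • siteToE z) = 0
    · simp [hhz]
    have hw : 0 ≤ f (a β • siteToE x) * g (a β • siteToE y) * h (a β • siteToE z) :=
      mul_nonneg (mul_nonneg (hf0 _) (hg0 _)) (hh0 _)
    calc ν₃ * a β ^ 12 * (f (a β • siteToE x) * g (a β • siteToE y) * h (a β • siteToE z))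
        = f (a β • siteToE x) * g (a β • siteToE y) * h (a β • siteToE z) * (ν₃ * a β ^ 12) := by ring
      _ ≤ f (a β • siteToE x) * g (a β • siteToE y) * h (a β • siteToE z) * (sgn * torusK3 G r β L x y z) :=
          mul_le_mul_of_nonneg_left (hc x hx y hy z hz hfx hgy hhz) hw
      _ = sgn * (f (a β • siteToE x) * g (a β • siteToE y) * h (a β • siteToE z) * torusK3 G r β L x y z) := by
          ring
  -- envelope sums: drop the absolute values, move to the reference box
  have hfabs : ∑ x ∈ box 4 L, f (a β • siteToE x) = ∑ x ∈ box 4 L, |f (a β • siteToE x)| :=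
    Finset.sum_congr rfl fun x _ => (abs_of_nonneg (hf0 _)).symm
  have hgabs : ∑ y ∈ box 4 L, g (a β • siteToE y) = ∑ y ∈ box 4 L, |g (a β • siteToE y)| :=
    Finset.sum_congr rfl fun y _ => (abs_of_nonneg (hg0 _)).symm
  have hhabs : ∑ z ∈ box 4 L, h (a β • siteToE z) = ∑ z ∈ box 4 L, |h (a β • siteToE z)| :=
    Finset.sum_congr rfl fun z _ => (abs_of_nonneg (hh0 _)).symm
  have hfeq := CeilingPrice.sum_box_eq_sum_box_of_cover (φ := fun u => |f u|) (ha β)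
    (CeilingPrice.tsupport_abs_subset hfσ) (hL₁σ β) (hcov β L hσL)
  have hgeq := CeilingPrice.sum_box_eq_sum_box_of_cover (φ := fun u => |g u|) (ha β)
    (CeilingPrice.tsupport_abs_subset hgσ) (hL₁σ β) (hcov β L hσL)
  have hheq := CeilingPrice.sum_box_eq_sum_box_of_cover (φ := fun u => |h u|) (ha β)
    (CeilingPrice.tsupport_abs_subset hhσ) (hL₁σ β) (hcov β L hσL)
  rw [hfabs, hgabs, hhabs, hfeq, hgeq, hheq] at hq
  have e : ν₃ * a β ^ 12 * ((∑ x ∈ box 4 (L₁ β), |f (a β • siteToE x)|) *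
      (∑ y ∈ box 4 (L₁ β), |g (a β • siteToE y)|) * (∑ z ∈ box 4 (L₁ β), |h (a β • siteToE z)|)) =
      ν₃ * ((a β ^ 4 * ∑ x ∈ box 4 (L₁ β), |f (a β • siteToE x)|) *
        (a β ^ 4 * ∑ y ∈ box 4 (L₁ β), |g (a β • siteToE y)|) * (a β ^ 4 * ∑ z ∈ box 4 (L₁ β), |h (a β • siteToE z)|)) := by
    ring
  rw [e] at hq
  have habs : sgn * Q3 G r β L (a β) f g h ≤ |Q3 G r β L (a β) f g h| := by
    rcases hsgn with h1 | h1 <;> rw [h1]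
    · rw [one_mul]; exact le_abs_self _
    · rw [neg_one_mul]; exact neg_le_abs _
  refine le_trans ?_ (hq.trans habs)
  have := mul_le_mul_of_nonneg_left hPβ.le hν₃.le
  linarith

/-- **`LowerBoundsK` from the two volume-uniform floors in the same units** (bodies of `UniformTwoPointFloor G r a`
and `UniformThreePointFloor G r a`); K-twin of the line's `lowerBounds_of_floors`. [folklore] -/
theorem lowerBoundsK_of_uniformFloors (a : ℝ → ℝ) (ha : ∀ β, 0 < a β) (ha0 : Tendsto a atTop (𝓝 0))
    (h2 : ∃ ν s₀ s₁ β₅ Λ₅ : ℝ, 0 < ν ∧ 0 < s₀ ∧ s₀ < s₁ ∧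
      ∀ β : ℝ, β₅ ≤ β → ∀ L : ℕ, Λ₅ ≤ a β * L → ∀ x ∈ box 4 L, ∀ y ∈ box 4 L,
        s₀ ≤ a β * ‖siteToE (y - x)‖ → a β * ‖siteToE (y - x)‖ ≤ s₁ →
          ν * a β ^ 8 ≤ torusE G r β L (fun U => dens G r x U * dens G r y U) -
            torusE G r β L (dens G r x) * torusE G r β L (dens G r y))
    (h3 : ∃ (p₁ p₂ p₃ : EuclideanSpace ℝ (Fin 4)) (ρ ν₃ sgn β₅ Λ₅ : ℝ), 0 < ρ ∧
      2 * ρ < dist p₁ p₂ ∧ 2 * ρ < dist p₂ p₃ ∧ 2 * ρ < dist p₁ p₃ ∧ 0 < ν₃ ∧ (sgn = 1 ∨ sgn = -1) ∧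
      ∀ β : ℝ, β₅ ≤ β → ∀ L : ℕ, Λ₅ ≤ a β * L → ∀ x ∈ box 4 L, ∀ y ∈ box 4 L, ∀ z ∈ box 4 L,
        a β • siteToE x ∈ closedBall p₁ ρ → a β • siteToE y ∈ closedBall p₂ ρ → a β • siteToE z ∈ closedBall p₃ ρ →
          ν₃ * a β ^ 12 ≤ sgn * torusK3 G r β L x y z) :
    LowerBoundsK G r a := by
  obtain ⟨ν, s₀, s₁, β₅, Λ₅, hν, hs₀, hs₀₁, hfl⟩ := h2
  obtain ⟨p₁, p₂, p₃, ρ, ν₃, sgn, β₅', Λ₅', hρ, h12, h23, h13, hν₃, hsgn, hfl'⟩ := h3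
  exact ⟨floorK_fst_of_pointwiseWindowFloor G r a ha ha0 hν hs₀ hs₀₁ hfl,
    floorK_snd_of_signedCloudFloor G r a ha ha0 hρ h12 h23 h13 hν₃ hsgn hfl'⟩

end Floors

/-- **N from the NT line «n32-variance»** — if every SU(2)-class `G` carries one `(r, a)` (`0 < a`, `a → 0`) with the
volume-uniform pointwise two-point window floor (body of `UniformTwoPointFloor G r a`, = stub `N32T` at `G`) and the
signed three-point cloud floor (body of `UniformThreePointFloor G r a`, = what stub `K3T` yields at `(r, a)`), then the
leaf's registered stub N `OnsetFloorsK` holds.  By-name form `N32T → K3T → OnsetFloorsK` is the one-liner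
`onsetFloorsK_of_uniformFloors (fun G _ _ _ _ hG _ => let ⟨r, a, ha, ha0, h2⟩ := n32 G hG; ⟨r, a, ha, ha0, h2, k3 G hG r a ha ha0 h2⟩)`
once the line's Defs module is in the tree. [folklore] -/
theorem onsetFloorsK_of_uniformFloors
    (h : ∀ (G : Type) [Group G] [TopologicalSpace G] [IsTopologicalGroup G] [CompactSpace G],
      IsCompactSimpleLieGroup G → Nonempty (G ≃ₜ* Matrix.specialUnitaryGroup (Fin 2) ℂ) →
      letI : MeasurableSpace G := borel G; haveI : BorelSpace G := ⟨rfl⟩;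
      ∃ (r : LatticeRep G) (a : ℝ → ℝ), (∀ β, 0 < a β) ∧ Tendsto a atTop (𝓝 0) ∧
        (∃ ν s₀ s₁ β₅ Λ₅ : ℝ, 0 < ν ∧ 0 < s₀ ∧ s₀ < s₁ ∧
          ∀ β : ℝ, β₅ ≤ β → ∀ L : ℕ, Λ₅ ≤ a β * L → ∀ x ∈ box 4 L, ∀ y ∈ box 4 L,
            s₀ ≤ a β * ‖siteToE (y - x)‖ → a β * ‖siteToE (y - x)‖ ≤ s₁ →
              ν * a β ^ 8 ≤ torusE G r β L (fun U => dens G r x U * dens G r y U) -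
                torusE G r β L (dens G r x) * torusE G r β L (dens G r y)) ∧
        (∃ (p₁ p₂ p₃ : EuclideanSpace ℝ (Fin 4)) (ρ ν₃ sgn β₅ Λ₅ : ℝ), 0 < ρ ∧
          2 * ρ < dist p₁ p₂ ∧ 2 * ρ < dist p₂ p₃ ∧ 2 * ρ < dist p₁ p₃ ∧ 0 < ν₃ ∧ (sgn = 1 ∨ sgn = -1) ∧
          ∀ β : ℝ, β₅ ≤ β → ∀ L : ℕ, Λ₅ ≤ a β * L → ∀ x ∈ box 4 L, ∀ y ∈ box 4 L, ∀ z ∈ box 4 L,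
            a β • siteToE x ∈ closedBall p₁ ρ → a β • siteToE y ∈ closedBall p₂ ρ →
              a β • siteToE z ∈ closedBall p₃ ρ → ν₃ * a β ^ 12 ≤ sgn * torusK3 G r β L x y z)) :
    OnsetFloorsK := by
  refine onsetFloorsK_of_lowerBoundsK fun G _ _ _ _ hG hcl => ?_
  letI : MeasurableSpace G := borel G
  haveI : BorelSpace G := ⟨rfl⟩
  obtain ⟨r, a, ha, ha0, h2, h3⟩ := h G hG hcl
  exact ⟨r, a, ha, ha0, lowerBoundsK_of_uniformFloors G r a ha ha0 h2 h3⟩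

end Summit.QuantumFields.YangMills.Cruxes.HypercubicOSDataFromInfiniteVolume.OnsetFloorsN

end
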